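import Summits.Ventures.LatticeQCDFlow.Exactness.ReversibleOperatorL2
import HarnessLib

/-!
# Partial Neumann sums as test observables of a reversible sampler, and Cauchy–Schwarz for the regularised Dirichlet form `Q_r`

HONEST FRAMING: exact (Metropolis-corrected) sampling algorithms for lattice gauge theory;
figures of merit are autocorrelation/cost numbers at stated couplings and volumes; no
continuum-physics claim.  (SCALAR calibration rung S0-A: not a gauge result.)

Venture `LatticeQCDFlow` (cell pub-lqcd), topic `Exactness`; FANOUT row 2 (`s0-phi4`).  NEW WORK
of the cell over `Exactness/ReversibleOperatorL2.lean` (the admissible-class format `RevOp` of a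
reversible exact sampler: weight `w ≥ 0`, class `A`, operator `K` with (int) (comb) (stab) (lin)
(symm) (contr)).  Nothing is cited as a fact.  This file is the elementary toolbox of the
variational (`H₋₁`) floor `Exactness/ReversibleVariationalFloor.lean`: the RESOLVENT of `K` is
not available on an admissible class (no completeness), so its partial Neumann sums
`S_N = Σ_{k<N} rᵏ Kᵏ g` (which ARE in the class) serve as test observables, and the
nonnegative form `Q_r(f) = ∫ f² w − r ∫ f (K f) w` (`0 ≤ r ≤ 1`) replaces the `H₁` norm.

## What is proved (namespace `RevOp`; `C_g(k) = ∫ g (Kᵏ g) w`)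

* `abs_autocov_le` — `|C_g(m)| ≤ C_g(0)` (Cauchy–Schwarz + contraction);
  `quadForm_nonneg` — `0 ≤ ∫ f² w − r ∫ f (K f) w` for `0 ≤ r ≤ 1`;
  `summable_autocov_mul_pow` — the ABEL SUM `Σ_k C_g(k) rᵏ` converges absolutely for `0 ≤ r < 1`;
* `neumann_mem` — `S_N ∈ A`; `op_neumann` — `K S_N = Σ_{k<N} rᵏ K^{k+1} g` pointwise (linearity);
  **`neumann_sub_op`** — the resolvent identity `S_N − r K S_N = g − r^N K^N g` pointwise;
  `integral_sum_mul` — `∫ (Σ_{k<N} c_k F_k) h w = Σ_{k<N} c_k ∫ F_k h w` on the class;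
* **`sq_rInner_le`** — Cauchy–Schwarz for `Q_r`: for `f, v ∈ A` and `0 ≤ r ≤ 1`,
  `(∫ f v w − r ∫ (K f) v w)² ≤ Q_r(f) · Q_r(v)` (the discriminant of `t ↦ Q_r(f + t v) ≥ 0`,
  symmetry moves `K` across).

NOT CLAIMED: anything about a particular sampler; these are format-level identities used by the
variational floor and its lattice instances.
-/

namespace Summit.Ventures.LatticeQCDFlow.Exactness

open Real MeasureTheory Filter Finset Topology
open Summit.Ventures.LatticeQCDFlow.Scoring

namespace RevOp

variable {X : Type*} [MeasurableSpace X] {μ : Measure X} {w : X → ℝ} {A : (X → ℝ) → Prop}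
  {K : (X → ℝ) → (X → ℝ)}

/-! ## §1 Elementary bounds -/

/-- **Autocovariances are bounded by the variance**: `|∫ g (Kᵐ g) w| ≤ ∫ g² w` (Cauchy–Schwarz and
the contraction property of `Kᵐ`). -/
theorem abs_autocov_le (hw0 : ∀ x, 0 ≤ w x)
    (hAi : ∀ ⦃f h : X → ℝ⦄, A f → A h → Integrable (fun x => f x * h x * w x) μ)
    (hAK : ∀ ⦃f : X → ℝ⦄, A f → A (K f))
    (hcontr : ∀ ⦃f : X → ℝ⦄, A f → ∫ x, K f x ^ 2 * w x ∂μ ≤ ∫ x, f x ^ 2 * w x ∂μ)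
    {g : X → ℝ} (hg : A g) (m : ℕ) :
    |∫ x, g x * (K^[m] g) x * w x ∂μ| ≤ ∫ x, g x ^ 2 * w x ∂μ := by
  have hgm := iterate_mem hAK m hg
  have hP0 : 0 ≤ ∫ x, g x ^ 2 * w x ∂μ := integral_nonneg fun x => mul_nonneg (sq_nonneg _) (hw0 x)
  have hCS := sq_integral_mul_le hw0 hAi hg hgm
  have hc := iterate_contr hAK hcontr m hg
  have hsq : (∫ x, g x * (K^[m] g) x * w x ∂μ) ^ 2 ≤ (∫ x, g x ^ 2 * w x ∂μ) ^ 2 := by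
    calc (∫ x, g x * (K^[m] g) x * w x ∂μ) ^ 2
        ≤ (∫ x, g x ^ 2 * w x ∂μ) * ∫ x, (K^[m] g) x ^ 2 * w x ∂μ := hCS
      _ ≤ (∫ x, g x ^ 2 * w x ∂μ) * ∫ x, g x ^ 2 * w x ∂μ := mul_le_mul_of_nonneg_left hc hP0
      _ = (∫ x, g x ^ 2 * w x ∂μ) ^ 2 := by ring
  exact abs_le_of_sq_le_sq' hsq hP0 |> fun h => abs_le.mpr h

/-- **The regularised Dirichlet form is nonnegative**: `0 ≤ ∫ f² w − r ∫ f (K f) w` for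
`0 ≤ r ≤ 1` and `f ∈ A`. -/
theorem quadForm_nonneg (hw0 : ∀ x, 0 ≤ w x)
    (hAi : ∀ ⦃f h : X → ℝ⦄, A f → A h → Integrable (fun x => f x * h x * w x) μ)
    (hAK : ∀ ⦃f : X → ℝ⦄, A f → A (K f))
    (hcontr : ∀ ⦃f : X → ℝ⦄, A f → ∫ x, K f x ^ 2 * w x ∂μ ≤ ∫ x, f x ^ 2 * w x ∂μ)
    {f : X → ℝ} (hf : A f) {r : ℝ} (hr0 : 0 ≤ r) (hr1 : r ≤ 1) :
    0 ≤ (∫ x, f x ^ 2 * w x ∂μ) - r * ∫ x, f x * K f x * w x ∂μ := by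
  have hP0 : 0 ≤ ∫ x, f x ^ 2 * w x ∂μ := integral_nonneg fun x => mul_nonneg (sq_nonneg _) (hw0 x)
  have h := abs_autocov_le hw0 hAi hAK hcontr hf 1
  simp only [Function.iterate_one] at h
  have h1 : ∫ x, f x * K f x * w x ∂μ ≤ ∫ x, f x ^ 2 * w x ∂μ := (le_abs_self _).trans h
  nlinarith

/-- **The Abel sum converges**: `k ↦ C_g(k) rᵏ` is summable for `0 ≤ r < 1`. -/
theorem summable_autocov_mul_pow (hw0 : ∀ x, 0 ≤ w x)
    (hAi : ∀ ⦃f h : X → ℝ⦄, A f → A h → Integrable (fun x => f x * h x * w x) μ)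
    (hAK : ∀ ⦃f : X → ℝ⦄, A f → A (K f))
    (hcontr : ∀ ⦃f : X → ℝ⦄, A f → ∫ x, K f x ^ 2 * w x ∂μ ≤ ∫ x, f x ^ 2 * w x ∂μ)
    {g : X → ℝ} (hg : A g) {r : ℝ} (hr0 : 0 ≤ r) (hr1 : r < 1) :
    Summable fun k => (∫ x, g x * (K^[k] g) x * w x ∂μ) * r ^ k := by
  refine Summable.of_norm_bounded
    ((summable_geometric_of_lt_one hr0 hr1).mul_left (∫ x, g x ^ 2 * w x ∂μ)) fun k => ?_
  rw [norm_mul, norm_pow, Real.norm_eq_abs, Real.norm_eq_abs, abs_of_nonneg hr0]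
  exact mul_le_mul_of_nonneg_right (abs_autocov_le hw0 hAi hAK hcontr hg k) (pow_nonneg hr0 k)

/-! ## §2 The partial Neumann sums `S_N = Σ_{k<N} rᵏ Kᵏ g` -/

omit [MeasurableSpace X] in
/-- The partial Neumann sums are admissible: `S_N = Σ_{k<N} rᵏ Kᵏ g ∈ A`. -/
theorem neumann_mem (hAc : ∀ ⦃f h : X → ℝ⦄ (c : ℝ), A f → A h → A (fun x => f x + c * h x))
    (hAK : ∀ ⦃f : X → ℝ⦄, A f → A (K f)) {g : X → ℝ} (hg : A g) (r : ℝ) :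
    ∀ N : ℕ, A (fun x => ∑ k ∈ Finset.range N, r ^ k * (K^[k] g) x)
  | 0 => by
    have h := hAc (-1) hg hg
    have e : (fun x => g x + (-1) * g x)
        = fun x => ∑ k ∈ Finset.range 0, r ^ k * (K^[k] g) x := by
      funext x; simp
    rw [e] at h
    exact h
  | N + 1 => by
    have h := hAc (r ^ N) (neumann_mem hAc hAK hg r N) (iterate_mem hAK N hg)
    have e : (fun x => (∑ k ∈ Finset.range N, r ^ k * (K^[k] g) x) + r ^ N * (K^[N] g) x)
        = fun x => ∑ k ∈ Finset.range (N + 1), r ^ k * (K^[k] g) x := by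
      funext x; rw [Finset.sum_range_succ]
    rw [e] at h
    exact h

omit [MeasurableSpace X] in
/-- **`K` through a partial Neumann sum**: `K S_N = Σ_{k<N} rᵏ K^{k+1} g` (linearity on the class). -/
theorem op_neumann (hAc : ∀ ⦃f h : X → ℝ⦄ (c : ℝ), A f → A h → A (fun x => f x + c * h x))
    (hAK : ∀ ⦃f : X → ℝ⦄, A f → A (K f))
    (hlin : ∀ ⦃f h : X → ℝ⦄ (c : ℝ), A f → A h →
      ∀ x, K (fun s => f s + c * h s) x = K f x + c * K h x)
    {g : X → ℝ} (hg : A g) (r : ℝ) :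
    ∀ (N : ℕ) (x : X), K (fun y => ∑ k ∈ Finset.range N, r ^ k * (K^[k] g) y) x
      = ∑ k ∈ Finset.range N, r ^ k * (K^[k + 1] g) x
  | 0, x => by
    have h := hlin (-1) hg hg x
    have e : (fun s => g s + (-1) * g s)
        = fun y => ∑ k ∈ Finset.range 0, r ^ k * (K^[k] g) y := by
      funext s; simp
    rw [e] at h
    rw [h]
    simp
  | N + 1, x => by
    have hS := neumann_mem hAc hAK hg r N
    have h := hlin (r ^ N) hS (iterate_mem hAK N hg) x
    have e : (fun s => (∑ k ∈ Finset.range N, r ^ k * (K^[k] g) s) + r ^ N * (K^[N] g) s)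
        = fun y => ∑ k ∈ Finset.range (N + 1), r ^ k * (K^[k] g) y := by
      funext s; rw [Finset.sum_range_succ]
    rw [e] at h
    rw [h, op_neumann hAc hAK hlin hg r N x, Finset.sum_range_succ,
      ← Function.iterate_succ_apply' K N g]

omit [MeasurableSpace X] in
/-- **The resolvent identity** of the partial Neumann sums: `S_N − r K S_N = g − r^N K^N g`
pointwise. -/
theorem neumann_sub_op (hAc : ∀ ⦃f h : X → ℝ⦄ (c : ℝ), A f → A h → A (fun x => f x + c * h x))
    (hAK : ∀ ⦃f : X → ℝ⦄, A f → A (K f))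
    (hlin : ∀ ⦃f h : X → ℝ⦄ (c : ℝ), A f → A h →
      ∀ x, K (fun s => f s + c * h s) x = K f x + c * K h x)
    {g : X → ℝ} (hg : A g) (r : ℝ) (N : ℕ) (x : X) :
    (∑ k ∈ Finset.range N, r ^ k * (K^[k] g) x)
        - r * K (fun y => ∑ k ∈ Finset.range N, r ^ k * (K^[k] g) y) x
      = g x - r ^ N * (K^[N] g) x := by
  rw [op_neumann hAc hAK hlin hg r N x, Finset.mul_sum]
  have e : ∀ k ∈ Finset.range N, r * (r ^ k * (K^[k + 1] g) x) = r ^ (k + 1) * (K^[k + 1] g) x := by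
    intro k _; ring
  rw [Finset.sum_congr rfl e, ← Finset.sum_sub_distrib,
    Finset.sum_range_sub' (fun k => r ^ k * (K^[k] g) x) N]
  simp

/-- Integrals of finite combinations of admissible observables against `h ∈ A`, term by term:
`∫ (Σ_{k<N} c_k F_k) h w = Σ_{k<N} c_k ∫ F_k h w`. -/
theorem integral_sum_mul
    (hAi : ∀ ⦃f h : X → ℝ⦄, A f → A h → Integrable (fun x => f x * h x * w x) μ)
    {F : ℕ → X → ℝ} (hF : ∀ k, A (F k)) {h : X → ℝ} (hh : A h) (c : ℕ → ℝ) (N : ℕ) :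
    ∫ x, (∑ k ∈ Finset.range N, c k * F k x) * h x * w x ∂μ
      = ∑ k ∈ Finset.range N, c k * ∫ x, F k x * h x * w x ∂μ := by
  have e : ∀ x, (∑ k ∈ Finset.range N, c k * F k x) * h x * w x
      = ∑ k ∈ Finset.range N, c k * (F k x * h x * w x) := by
    intro x
    rw [Finset.sum_mul, Finset.sum_mul]
    exact Finset.sum_congr rfl fun k _ => by ring
  simp_rw [e]
  rw [integral_finsetSum _ fun k _ => (hAi (hF k) hh).const_mul (c k)]
  exact Finset.sum_congr rfl fun k _ => integral_const_mul _ _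

/-! ## §3 Cauchy–Schwarz for the regularised Dirichlet form -/

/-- **Cauchy–Schwarz for `Q_r`**: for `0 ≤ r ≤ 1` and `f, v ∈ A`,
`(∫ f v w − r ∫ (K f) v w)² ≤ (∫ f² w − r ∫ f (Kf) w)(∫ v² w − r ∫ v (Kv) w)`
(the discriminant of `t ↦ Q_r(f + t v) ≥ 0`, with `∫ f (K v) w = ∫ (K f) v w` by symmetry). -/
theorem sq_rInner_le (hw0 : ∀ x, 0 ≤ w x)
    (hAi : ∀ ⦃f h : X → ℝ⦄, A f → A h → Integrable (fun x => f x * h x * w x) μ)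
    (hAc : ∀ ⦃f h : X → ℝ⦄ (c : ℝ), A f → A h → A (fun x => f x + c * h x))
    (hAK : ∀ ⦃f : X → ℝ⦄, A f → A (K f))
    (hlin : ∀ ⦃f h : X → ℝ⦄ (c : ℝ), A f → A h →
      ∀ x, K (fun s => f s + c * h s) x = K f x + c * K h x)
    (hsymm : ∀ ⦃f h : X → ℝ⦄, A f → A h →
      ∫ x, K f x * h x * w x ∂μ = ∫ x, f x * K h x * w x ∂μ)
    (hcontr : ∀ ⦃f : X → ℝ⦄, A f → ∫ x, K f x ^ 2 * w x ∂μ ≤ ∫ x, f x ^ 2 * w x ∂μ)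
    {f v : X → ℝ} (hf : A f) (hv : A v) {r : ℝ} (hr0 : 0 ≤ r) (hr1 : r ≤ 1) :
    ((∫ x, f x * v x * w x ∂μ) - r * ∫ x, K f x * v x * w x ∂μ) ^ 2
      ≤ ((∫ x, f x ^ 2 * w x ∂μ) - r * ∫ x, f x * K f x * w x ∂μ)
        * ((∫ x, v x ^ 2 * w x ∂μ) - r * ∫ x, v x * K v x * w x ∂μ) := by
  have hKf := hAK hf
  have hKv := hAK hv
  have iff := integrable_sq_mul hAi hf
  have ivv := integrable_sq_mul hAi hv
  have ifv := hAi hf hv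
  have ifKf := hAi hf hKf
  have iKfv := hAi hKf hv
  have ivKv := hAi hv hKv
  have ivKf := hAi hv hKf
  have hvKf : ∫ x, v x * K f x * w x ∂μ = ∫ x, K f x * v x * w x ∂μ :=
    integral_congr_ae (Eventually.of_forall fun x => by ring)
  have hfKv : ∫ x, f x * K v x * w x ∂μ = ∫ x, K f x * v x * w x ∂μ := (hsymm hf hv).symm
  set P := ∫ x, f x ^ 2 * w x ∂μ with hP
  set P1 := ∫ x, f x * K f x * w x ∂μ with hP1
  set B := ∫ x, f x * v x * w x ∂μ with hB
  set B1 := ∫ x, K f x * v x * w x ∂μ with hB1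
  set D := ∫ x, v x ^ 2 * w x ∂μ with hD
  set D1 := ∫ x, v x * K v x * w x ∂μ with hD1
  have key : ∀ t : ℝ, 0 ≤ (D - r * D1) * (t * t) + 2 * (B - r * B1) * t + (P - r * P1) := by
    intro t
    have hft : A (fun x => f x + t * v x) := hAc t hf hv
    have h0 := quadForm_nonneg hw0 hAi hAK hcontr hft hr0 hr1
    -- expand `∫ (f + t v)² w`
    have e1 : ∀ x, (f x + t * v x) ^ 2 * w x
        = f x ^ 2 * w x + 2 * t * (f x * v x * w x) + t * t * (v x ^ 2 * w x) := fun x => by ring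
    have i2 : Integrable (fun x => 2 * t * (f x * v x * w x)) μ := ifv.const_mul _
    have i3 : Integrable (fun x => t * t * (v x ^ 2 * w x)) μ := ivv.const_mul _
    have i12 : Integrable (fun x => f x ^ 2 * w x + 2 * t * (f x * v x * w x)) μ := iff.add i2
    have eA : ∫ x, (f x + t * v x) ^ 2 * w x ∂μ = P + 2 * t * B + t * t * D := by
      simp_rw [e1]
      rw [integral_add i12 i3, integral_add iff i2, integral_const_mul, integral_const_mul]
    -- expand `∫ (f + t v) K(f + t v) w`
    have e2 : ∀ x, (f x + t * v x) * K (fun s => f s + t * v s) x * w x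
        = f x * K f x * w x + t * (f x * K v x * w x) + t * (v x * K f x * w x)
          + t * t * (v x * K v x * w x) := by
      intro x
      rw [hlin t hf hv x]
      ring
    have j2 : Integrable (fun x => t * (f x * K v x * w x)) μ := (hAi hf hKv).const_mul _
    have j3 : Integrable (fun x => t * (v x * K f x * w x)) μ := ivKf.const_mul _
    have j4 : Integrable (fun x => t * t * (v x * K v x * w x)) μ := ivKv.const_mul _
    have j12 : Integrable (fun x => f x * K f x * w x + t * (f x * K v x * w x)) μ := ifKf.add j2
    have j123 : Integrable (fun x => f x * K f x * w x + t * (f x * K v x * w x)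
        + t * (v x * K f x * w x)) μ := j12.add j3
    have eB : ∫ x, (f x + t * v x) * K (fun s => f s + t * v s) x * w x ∂μ
        = P1 + 2 * t * B1 + t * t * D1 := by
      simp_rw [e2]
      rw [integral_add j123 j4, integral_add j12 j3,
        integral_add ifKf j2, integral_const_mul, integral_const_mul, integral_const_mul,
        hfKv, hvKf]
      ring
    rw [eA, eB] at h0
    nlinarith
  have hd := discrim_le_zero key
  rw [discrim] at hd
  nlinarith [hd]

end RevOp

end Summit.Ventures.LatticeQCDFlow.Exactness
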